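import Summits.CriticalPhenomena.PercolationContinuityZ3.Theorems.Transplant.FKConnectivityAllQExchange
import Summits.CriticalPhenomena.PercolationContinuityZ3.Theorems.SoloBlindChainBK
import HarnessLib

/-!
# Connectivity correlation inequalities for `φ_{w,q}` — the exchange inequality K₀ HOLDS for every `q ≥ 1`

Support file (`--supports stmt-CriticalPhenomena-4575`), FK sub-lane `prim-bschramm-fk-1` (gen 8) of the post-continuity
programme; builds on p205010 (kernel theorem, internal audit signed; external expert review pending).  No definitions, no named
facts, no sorries; standard axioms.

`exchangeAdjOn_of_one_le : 1 ≤ q → ExchangeAdjOn V q`.  For `q ≥ 1` the two pairs `f, g` are positively correlated: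
`Z₁₀·Z₀₁ ≤ Z₁₁·Z₀₀` (FKG for the events `{f open}`, `{g open}` under the measure with both parameters set to `½`, whose four
state-masses are the `Z_{ab}/4` — `partition_products_le_of_one_le`), and `u_{ab} = φ_{w[f↦a][g↦b]}(C_x ∈ 𝒰)` is monotone in `a` (comparison
in `𝐩`, Grimmett Thm (3.21)), so `Z₁₀Z₀₁(u₀₁ − u₁₀) ≤ Z₁₁Z₀₀(u₀₁ − u₁₀)⁺ ≤ Z₁₁Z₀₀(u₁₁ − u₀₀)`.  So the node `ExchangeAdjFKPos` is a
theorem on `[1, ∞)` and conjectural exactly on `(0, 1)`, like MM / CA / Hub.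
[cite: Grimmett2006, Thm. (3.8) (p. 39); Thm. (3.21) (p. 43); Thm. (3.7) (p. 39)]
-/

noncomputable section

namespace Summit.CriticalPhenomena.PercolationContinuityZ3.Theorems

namespace FK

open MeasureTheory Set Literature.Probability.LatticeModels Literature.Probability.Percolation
open scoped Classical
open BHK2006 DecisionTree HullPort

variable {V : Type*} [Fintype V]

/-! ### Masses of the edge events under revealed parameters -/

/-- Under a parameter vector with `u f = 1`: `φ_u(A ∩ {f open}) = φ_u(A)`. [cite: Grimmett2006, §1.4 eq. (1.20) (p. 15)] -/
theorem real_inter_open_of_one (u : Sym2 V → unitInterval) {q : ℝ} (hq : 0 < q) {f : Sym2 V} (hf : u f = 1)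
    (A : Set (BondConfig V)) : (rcMeasureW u q ∅).real (A ∩ {ω | f ∈ ω}) = (rcMeasureW u q ∅).real A := by
  rw [real_eq_rcE_ind u hq, real_eq_rcE_ind u hq]
  refine rcE_congr_support u q fun ω hω => ?_
  have hfo : f ∈ ω := (mem_of_rcMass_ne_zero u q hω).1 f hf
  by_cases h : ω ∈ A
  · rw [ind_of_mem h, ind_of_mem (show ω ∈ A ∩ {ω | f ∈ ω} from ⟨h, hfo⟩)]
  · rw [ind_of_not_mem h, ind_of_not_mem (show ω ∉ A ∩ {ω | f ∈ ω} from fun h' => h h'.1)]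

/-- Under a parameter vector with `u f = 0`: `φ_u(A ∩ {f open}) = 0`. [cite: Grimmett2006, §1.4 eq. (1.20) (p. 15)] -/
theorem real_inter_open_of_zero (u : Sym2 V → unitInterval) {q : ℝ} (hq : 0 < q) {f : Sym2 V} (hf : u f = 0)
    (A : Set (BondConfig V)) : (rcMeasureW u q ∅).real (A ∩ {ω | f ∈ ω}) = 0 := by
  rw [real_eq_rcE_ind u hq]
  have h0 : rcE u q (fun _ => (0 : ℝ)) = 0 := by unfold rcE; simp
  rw [← h0]
  refine rcE_congr_support u q fun ω hω => ?_
  exact ind_of_not_mem (show ω ∉ A ∩ {ω | f ∈ ω} from fun h' => (mem_of_rcMass_ne_zero u q hω).2 f hf h'.2)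

/-! ### Positive correlation of two pairs for `q ≥ 1`, as an inequality between the four partition functions -/

/-- **`Z₁₀·Z₀₁ ≤ Z₁₁·Z₀₀` for `q ≥ 1`** (`Z_{ab} = Z(w[f↦a][g↦b])`, `f ≠ g`): positive correlation of the increasing events
`{f open}`, `{g open}` under `φ_{w[f↦½][g↦½]}` (FKG, Grimmett Thm (3.8)), whose state masses are `Z_{ab}/4`.
[cite: Grimmett2006, Thm. (3.8) (p. 39); Thm. (3.7) (p. 39)] -/
theorem partition_products_le_of_one_le (w : Sym2 V → unitInterval) {q : ℝ} (hq : 1 ≤ q) {f g : Sym2 V} (hfg : f ≠ g) :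
    rcPartitionFunctionW (Function.update (Function.update w f 1) g 0) q ∅ *
        rcPartitionFunctionW (Function.update (Function.update w f 0) g 1) q ∅ ≤
      rcPartitionFunctionW (Function.update (Function.update w f 1) g 1) q ∅ *
        rcPartitionFunctionW (Function.update (Function.update w f 0) g 0) q ∅ := by
  have hq0 : 0 < q := one_pos.trans_le hq
  let half : unitInterval := ⟨1 / 2, by norm_num, by norm_num⟩
  have coe_half : ((half : unitInterval) : ℝ) = 1 / 2 := rfl
  set u : Sym2 V → unitInterval := Function.update (Function.update w f half) g half with hu
  have hug : (u g : ℝ) = 1 / 2 := by rw [hu, Function.update_self, coe_half]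
  have huf : ∀ c : unitInterval, ((Function.update u g c) f : ℝ) = 1 / 2 := by
    intro c; rw [Function.update_of_ne hfg, hu, Function.update_of_ne hfg, Function.update_self, coe_half]
  -- the doubly revealed vectors of `u` are those of `w`
  have rev : ∀ a c : unitInterval, Function.update (Function.update u g c) f a = Function.update (Function.update w f a) g c := by
    intro a c
    funext e
    by_cases h1 : e = f
    · subst h1; rw [Function.update_self, Function.update_of_ne hfg, Function.update_self]
    · rw [Function.update_of_ne h1]
      by_cases h2 : e = g
      · subst h2; rw [Function.update_self, Function.update_self]
      · rw [Function.update_of_ne h2, Function.update_of_ne h2, Function.update_of_ne h1, hu, Function.update_of_ne h2,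
          Function.update_of_ne h1]
  -- abbreviations for the four vectors
  set w11 := Function.update (Function.update w f 1) g 1 with hw11
  set w10 := Function.update (Function.update w f 1) g 0 with hw10
  set w01 := Function.update (Function.update w f 0) g 1 with hw01
  set w00 := Function.update (Function.update w f 0) g 0 with hw00
  set F : Set (BondConfig V) := {ω | f ∈ ω} with hF
  set G : Set (BondConfig V) := {ω | g ∈ ω} with hG
  -- masses of events under `u` in terms of the four vectors
  have mass : ∀ A : Set (BondConfig V), rcPartitionFunctionW u q ∅ * (rcMeasureW u q ∅).real A =
      1 / 2 * (1 / 2 * (rcPartitionFunctionW w11 q ∅ * (rcMeasureW w11 q ∅).real A) +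
        (1 - 1 / 2) * (rcPartitionFunctionW w01 q ∅ * (rcMeasureW w01 q ∅).real A)) +
      (1 - 1 / 2) * (1 / 2 * (rcPartitionFunctionW w10 q ∅ * (rcMeasureW w10 q ∅).real A) +
        (1 - 1 / 2) * (rcPartitionFunctionW w00 q ∅ * (rcMeasureW w00 q ∅).real A)) := by
    intro A
    rw [mass_split u hq0 g A, hug, mass_split (Function.update u g 1) hq0 f A, mass_split (Function.update u g 0) hq0 f A,
      huf, huf, rev, rev, rev, rev]
  -- values of the parameters of `f`, `g` in the four vectors
  have vg11 : w11 g = 1 := by rw [hw11]; simp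
  have vg01 : w01 g = 1 := by rw [hw01]; simp
  have vg10 : w10 g = 0 := by rw [hw10]; simp
  have vg00 : w00 g = 0 := by rw [hw00]; simp
  have vf11 : w11 f = 1 := by rw [hw11, Function.update_of_ne hfg]; simp
  have vf10 : w10 f = 1 := by rw [hw10, Function.update_of_ne hfg]; simp
  have vf01 : w01 f = 0 := by rw [hw01, Function.update_of_ne hfg]; simp
  have vf00 : w00 f = 0 := by rw [hw00, Function.update_of_ne hfg]; simp
  haveI i11 := isProbabilityMeasure_rcMeasureW w11 hq0 (∅ : Set V)
  haveI i01 := isProbabilityMeasure_rcMeasureW w01 hq0 (∅ : Set V)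
  haveI i10 := isProbabilityMeasure_rcMeasureW w10 hq0 (∅ : Set V)
  haveI i00 := isProbabilityMeasure_rcMeasureW w00 hq0 (∅ : Set V)
  haveI iu := isProbabilityMeasure_rcMeasureW u hq0 (∅ : Set V)
  -- F under the four vectors
  have F11 : (rcMeasureW w11 q ∅).real F = 1 := by
    have := real_inter_open_of_one w11 hq0 vf11 Set.univ; rw [Set.univ_inter] at this; rw [this, probReal_univ]
  have F10 : (rcMeasureW w10 q ∅).real F = 1 := by
    have := real_inter_open_of_one w10 hq0 vf10 Set.univ; rw [Set.univ_inter] at this; rw [this, probReal_univ]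
  have F01 : (rcMeasureW w01 q ∅).real F = 0 := by
    have := real_inter_open_of_zero w01 hq0 vf01 Set.univ; rw [Set.univ_inter] at this; exact this
  have F00 : (rcMeasureW w00 q ∅).real F = 0 := by
    have := real_inter_open_of_zero w00 hq0 vf00 Set.univ; rw [Set.univ_inter] at this; exact this
  have G11 : (rcMeasureW w11 q ∅).real G = 1 := by
    have := real_inter_open_of_one w11 hq0 vg11 Set.univ; rw [Set.univ_inter] at this; rw [this, probReal_univ]
  have G01 : (rcMeasureW w01 q ∅).real G = 1 := by
    have := real_inter_open_of_one w01 hq0 vg01 Set.univ; rw [Set.univ_inter] at this; rw [this, probReal_univ]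
  have G10 : (rcMeasureW w10 q ∅).real G = 0 := by
    have := real_inter_open_of_zero w10 hq0 vg10 Set.univ; rw [Set.univ_inter] at this; exact this
  have G00 : (rcMeasureW w00 q ∅).real G = 0 := by
    have := real_inter_open_of_zero w00 hq0 vg00 Set.univ; rw [Set.univ_inter] at this; exact this
  have FG11 : (rcMeasureW w11 q ∅).real (F ∩ G) = 1 := by rw [real_inter_open_of_one w11 hq0 vg11, F11]
  have FG01 : (rcMeasureW w01 q ∅).real (F ∩ G) = 0 := by rw [real_inter_open_of_one w01 hq0 vg01, F01]
  have FG10 : (rcMeasureW w10 q ∅).real (F ∩ G) = 0 := real_inter_open_of_zero w10 hq0 vg10 F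
  have FG00 : (rcMeasureW w00 q ∅).real (F ∩ G) = 0 := real_inter_open_of_zero w00 hq0 vg00 F
  have mFG := mass (F ∩ G)
  have mF := mass F
  have mG := mass G
  have mU := mass Set.univ
  rw [FG11, FG01, FG10, FG00] at mFG
  rw [F11, F01, F10, F00] at mF
  rw [G11, G01, G10, G00] at mG
  simp only [probReal_univ, mul_one] at mU
  -- FKG under `u`
  have fkg := rcMeasureW_fkg (w := u) hq ∅ (isUpperSet_setOf_mem f) (isUpperSet_setOf_mem g)
  have hZu := rcPartitionFunctionW_pos u hq0 (∅ : Set V)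
  have key : (rcPartitionFunctionW u q ∅ * (rcMeasureW u q ∅).real F) * (rcPartitionFunctionW u q ∅ * (rcMeasureW u q ∅).real G) ≤
      rcPartitionFunctionW u q ∅ * (rcPartitionFunctionW u q ∅ * (rcMeasureW u q ∅).real (F ∩ G)) := by
    have := mul_le_mul_of_nonneg_left fkg (mul_nonneg hZu.le hZu.le)
    nlinarith [this]
  rw [mF, mG, mFG, mU] at key
  nlinarith [key]

/-! ### K₀ for `q ≥ 1` -/

/-- **The exchange inequality holds for every `q ≥ 1`.** [cite: Grimmett2006, Thm. (3.8) (p. 39); Thm. (3.21) (p. 43)] -/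
theorem exchangeAdjOn_of_one_le {q : ℝ} (hq : 1 ≤ q) : ExchangeAdjOn V q := by
  intro w x z v b 𝒰 h𝒰 _
  have hA := isUpperSet_clusterIn x h𝒰
  -- monotonicity in the parameter of `f`
  have mono : ∀ c : unitInterval,
      (rcMeasureW (Function.update (Function.update w s(x, z) 0) s(v, b) c) q ∅).real (clusterIn x 𝒰) ≤
        (rcMeasureW (Function.update (Function.update w s(x, z) 1) s(v, b) c) q ∅).real (clusterIn x 𝒰) := by
    intro c
    refine rcMeasureW_real_mono_weights (fun e => ?_) hq ∅ hA
    by_cases h1 : e = s(v, b)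
    · subst h1; simp
    · rw [Function.update_of_ne h1, Function.update_of_ne h1]
      by_cases h2 : e = s(x, z)
      · subst h2; simp
      · rw [Function.update_of_ne h2, Function.update_of_ne h2]
  have m1 := mono 1
  have m0 := mono 0
  -- monotonicity in the parameter of `g`
  have monog : ∀ a : unitInterval,
      (rcMeasureW (Function.update (Function.update w s(x, z) a) s(v, b) 0) q ∅).real (clusterIn x 𝒰) ≤
        (rcMeasureW (Function.update (Function.update w s(x, z) a) s(v, b) 1) q ∅).real (clusterIn x 𝒰) := by
    intro a
    refine rcMeasureW_real_mono_weights (fun e => ?_) hq ∅ hA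
    by_cases h1 : e = s(v, b)
    · subst h1; simp
    · rw [Function.update_of_ne h1, Function.update_of_ne h1]
  have mg1 := monog 1
  have hq0 : 0 < q := one_pos.trans_le hq
  have hZ11 := (rcPartitionFunctionW_pos (Function.update (Function.update w s(x, z) 1) s(v, b) 1) hq0 (∅ : Set V)).le
  have hZ00 := (rcPartitionFunctionW_pos (Function.update (Function.update w s(x, z) 0) s(v, b) 0) hq0 (∅ : Set V)).le
  have hZ10 := (rcPartitionFunctionW_pos (Function.update (Function.update w s(x, z) 1) s(v, b) 0) hq0 (∅ : Set V)).le
  have hZ01 := (rcPartitionFunctionW_pos (Function.update (Function.update w s(x, z) 0) s(v, b) 1) hq0 (∅ : Set V)).le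
  by_cases hfg : s(x, z) = s(v, b)
  · -- degenerate `f = g`: both sides coincide
    rw [← hfg]
    simp only [Function.update_idem]
    apply le_of_eq; ring
  have hZ := partition_products_le_of_one_le w hq hfg
  by_cases hs : (rcMeasureW (Function.update (Function.update w s(x, z) 0) s(v, b) 1) q ∅).real (clusterIn x 𝒰) ≤
      (rcMeasureW (Function.update (Function.update w s(x, z) 1) s(v, b) 0) q ∅).real (clusterIn x 𝒰)
  · -- the left side is `≤ 0 ≤` the right side
    have l : rcPartitionFunctionW (Function.update (Function.update w s(x, z) 1) s(v, b) 0) q ∅ *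
        rcPartitionFunctionW (Function.update (Function.update w s(x, z) 0) s(v, b) 1) q ∅ *
        ((rcMeasureW (Function.update (Function.update w s(x, z) 0) s(v, b) 1) q ∅).real (clusterIn x 𝒰) -
          (rcMeasureW (Function.update (Function.update w s(x, z) 1) s(v, b) 0) q ∅).real (clusterIn x 𝒰)) ≤ 0 :=
      mul_nonpos_of_nonneg_of_nonpos (mul_nonneg hZ10 hZ01) (sub_nonpos.2 hs)
    have r : 0 ≤ rcPartitionFunctionW (Function.update (Function.update w s(x, z) 1) s(v, b) 1) q ∅ *
        rcPartitionFunctionW (Function.update (Function.update w s(x, z) 0) s(v, b) 0) q ∅ *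
        ((rcMeasureW (Function.update (Function.update w s(x, z) 1) s(v, b) 1) q ∅).real (clusterIn x 𝒰) -
          (rcMeasureW (Function.update (Function.update w s(x, z) 0) s(v, b) 0) q ∅).real (clusterIn x 𝒰)) :=
      mul_nonneg (mul_nonneg hZ11 hZ00) (by linarith [m0, mg1])
    linarith
  · push Not at hs
    have d : 0 ≤ (rcMeasureW (Function.update (Function.update w s(x, z) 0) s(v, b) 1) q ∅).real (clusterIn x 𝒰) -
        (rcMeasureW (Function.update (Function.update w s(x, z) 1) s(v, b) 0) q ∅).real (clusterIn x 𝒰) := by linarith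
    calc _ ≤ rcPartitionFunctionW (Function.update (Function.update w s(x, z) 1) s(v, b) 1) q ∅ *
          rcPartitionFunctionW (Function.update (Function.update w s(x, z) 0) s(v, b) 0) q ∅ *
          ((rcMeasureW (Function.update (Function.update w s(x, z) 0) s(v, b) 1) q ∅).real (clusterIn x 𝒰) -
            (rcMeasureW (Function.update (Function.update w s(x, z) 1) s(v, b) 0) q ∅).real (clusterIn x 𝒰)) :=
          mul_le_mul_of_nonneg_right hZ d
      _ ≤ _ := mul_le_mul_of_nonneg_left (by linarith [m0, m1, mg1]) (mul_nonneg hZ11 hZ00)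

/-- `ExchangeAdjFK q` for `q ≥ 1`. [cite: Grimmett2006, Thm. (3.8) (p. 39); Thm. (3.21) (p. 43)] -/
theorem exchangeAdjFK_of_one_le {q : ℝ} (hq : 1 ≤ q) : ExchangeAdjFK q := fun _ => exchangeAdjOn_of_one_le hq

end FK

end Summit.CriticalPhenomena.PercolationContinuityZ3.Theorems

end
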